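import Literature.Barriers.CriticalPhenomena.PlaquetteWalkHoleRootColumnLawWitness
import Literature.Barriers.CriticalPhenomena.PlaquetteWalkHoleRootHoleColumnAdjacentVF
import HarnessLib

/-!
# Barrier catalogue (SAWScalingLimit): the WOUND LEVEL-`7` WITNESS at the hole-column cell JUST ABOVE THE HOLE — the existence hypothesis of «VF ≢ 0 next to the hole»
discharged for every domain containing an `18`-face block («HOLE-COLUMN WITNESS»)

`Z → ∞` limit model of the printed Yang–Baxter weights [GlazmanManolescu2019, §1, eq. (1)]; the «RECTANGLE COEFFICIENT» line (b-engine-1 g29). In the reference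
frame of `PlaquetteWalkHoleRootColumnLawWitness` (root plaquette `w42 = (4,2)`, hole `(3,2)`) the shortest kind-(a) member at the hole-column cell `(3,3)`: east along
the root row to `p₁ = (5,2)`, north, the hook `(5,3)`, west along row `3` STRAIGHT through `(3,3)`, down column `2` across the western root row, east along row `1` under
the hole, north up column `6` (ONE eastern-ray crossing), west along the top row `4`, and down into `(3,3)` through its `N` side — `18` arcs, `7` isolated turns, cost `7`.

* `holeColBlock42`, `holeColMids42`, `holeColWalk`, `ωHC`, `ωHC_cert` — the reference witness and its kernel-decided certificates (first hit `4`, `18` arcs, no later arc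
  in the rhombus, odd eastern-ray count, STRAIGHT first arc, cost `7`, end `N`);
* ★★ `ΩG.exists_wound_cost_seven_straight_shift` — transport of a wound cost-`7` witness with a straight first arc and a slanted end to any translate
  (`exists_wound_cost_seven_turn_shift` with the two shape hypotheses exchanged);
* ★★★★ `exists_wound_cost_seven_holeColumn_adjacent_above` — every face list containing `holeColBlock w` carries, at `(w.1 − 1, w.2 + 1)`, a WOUND class-`B2a` walk
  from `w.side W` of limit cost `7` with a straight first arc and a slanted end;
* ★★★★★ `vertexFunctional_printed_zero_set_finite_holeColumn_adjacent_above_of_block` — hence `PlaquetteWalkHoleRootHoleColumnAdjacentVF`'s theorem with `hex`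
  DISCHARGED: for `Dl ⊇ holeColBlock w` missing the hole, **if every cost-`7` extension of a wound `NS` member at `(w.1 − 1, w.2 + 1)` has
  `limitWeight ∈ (√2)⁷·{ζ⁴, ζ⁸, ζ¹⁶, ζ²⁸}`, then `VF_{Dl}(w.side W, (w.1 − 1, w.2 + 1); ·)` has finitely many zeros in `(0, π)`** — the one remaining input is the
  class-`B2b` phase law (lane census: phases `2, 4, 7` only).

[GlazmanManolescu2019 §1 (definition of the model), Fig. 1, eq. (1), Lemma 2.1, Remark 2.2, §4.2 (translation invariance); Glazman2015WeightedSAW Lemma 3.1 (proof);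
CourantRobbins1958 Ch. V App. §2 (the even–odd rule).]
-/

noncomputable section

open Set Function Complex

open private IsNS from Literature.Probability.RandomPlanarGeometry.YangBaxterSAWGeneralDomain

namespace Literature.Probability.RandomPlanarGeometry.SAW.YangBaxter

open Real
open Literature.Barriers.CriticalPhenomena.PlaquetteWalk

/-! ## §1 Transport of a wound cost-`7` witness with a straight first arc and a slanted end -/

namespace ΩG

variable {D : Set Face} {w r : Face}

/-- ★★ **TRANSPORT OF A STRAIGHT, SLANTED-END WOUND WITNESS.** A class-`B2a` walk of the back-translated list at the reference root `(4,2)` and rhombus `r₀` with an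
odd eastern-ray count, a STRAIGHT first arc in `r₀`, limit cost `7` and a slanted end side yields in `dom Dl`, at the translated root and rhombus, a class-`B2a` walk
that is WOUND (`A_J ≠ 0`), has a straight first arc, limit cost `7` and the same end side (`exists_wound_cost_seven_turn_shift`, shape hypotheses exchanged).
[cite: GlazmanManolescu2019, §4.2 (translation invariance), Lemma 2.1] [cite: Glazman2015WeightedSAW, Lemma 3.1 (proof, pp. 6–7)]
[cite: CourantRobbins1958, Ch. V Appendix §2 (the even–odd rule)] -/
theorem exists_wound_cost_seven_straight_shift {Dl : List Face} {w r₀ : Face} {a' : MidEdge} {r' : Face} (ha : (w42.side .W).shiftBy (refShift w) = a')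
    (hrr : Face.shiftBy (refShift w) r₀ = r') (hr : RootedFace (dom Dl) a' r')
    (hr₀ : RootedFace (dom (Dl.map (Face.shiftBy (-refShift w)))) (w42.side .W) r₀)
    (ω₀ : ΩG (dom (Dl.map (Face.shiftBy (-refShift w)))) (w42.side .W) r₀) (h₀ : ω₀.IsB2a)
    (hodd : Odd ((Finset.range ω₀.Mv).filter fun j => eastRayB w42 (ω₀.2.nth (ω₀.2.firstHitG + j + 1)) = true).card)
    (hstr : arcKind (ω₀.2.sIn ω₀.2.firstHitG) (ω₀.2.sOut ω₀.2.firstHitG) = .straight)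
    (hc : cost (slotOfSide ω₀.1) ω₀.2.mids = 7) (hz : ω₀.1 = .N ∨ ω₀.1 = .S) :
    ∃ (ω : ΩG (dom Dl) a' r') (h : ω.IsB2a), ω.AJ hr h (toC (midPt a')) ≠ 0 ∧
      arcKind (ω.2.sIn ω.2.firstHitG) (ω.2.sOut ω.2.firstHitG) = .straight ∧ cost (slotOfSide ω.1) ω.2.mids = 7 ∧ (ω.1 = .N ∨ ω.1 = .S) := by
  subst ha hrr
  let ω : ΩG (dom Dl) ((w42.side .W).shiftBy (refShift w)) (Face.shiftBy (refShift w) r₀) :=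
    ⟨ω₀.1, (ω₀.2.shiftBy (refShift w)).castAll (preimage_dom_map_shiftBy_neg (refShift w) Dl) rfl
      (Face.side_shiftBy (refShift w) r₀ ω₀.1).symm⟩
  have hm : ω.2.mids = ω₀.2.mids.map (MidEdge.shiftBy (refShift w)) := rfl
  have h : ω.IsB2a := ΩG.isB2a_of_mids_shift hr₀ hm h₀
  refine ⟨ω, h, ?_, ?_, ?_, hz⟩
  · have hA₀ := AJ_root_ne_zero_of_odd_card ω₀ hr₀ h₀ hodd
    have hW₀ := (ω₀.AJ_root_ne_zero_iff_odd_rayCountAt (hr := hr₀) h₀ (b := w42) (τ := .W) rfl).1 hA₀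
    have hW : Odd (ω.rayCountAt hr h (Face.shiftBy (refShift w) w42) .W) := by
      rw [ΩG.rayCountAt_W_of_mids_shift (hr := hr₀) (hr' := hr) hm h₀ h w42]; exact hW₀
    exact (ω.AJ_root_ne_zero_iff_odd_rayCountAt (hr := hr) h (b := Face.shiftBy (refShift w) w42) (τ := .W)
      (Face.side_shiftBy (refShift w) w42 .W)).2 hW
  · have hF : ω.2.firstHitG = ω₀.2.firstHitG := YBWalk.firstHitG_eq_of_mids_shift hm
    obtain ⟨e1, e2⟩ := YBWalk.sIn_sOut_eq_of_mids_shift hm (i := ω₀.2.firstHitG) (ω₀.fh_lt h₀)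
    rw [hF, e1, e2]; exact hstr
  · show cost (slotOfSide ω₀.1) (ω₀.2.mids.map (MidEdge.shiftBy (refShift w))) = 7
    rw [cost_map_shiftBy]; exact hc

end ΩG

end Literature.Probability.RandomPlanarGeometry.SAW.YangBaxter

/-! ## §2 The reference witness at the root plaquette `(4,2)`: the kind-(a) member at the hole-column cell `(3,3)` -/

namespace Literature.Barriers.CriticalPhenomena.PlaquetteWalk

open Literature.Probability.RandomPlanarGeometry.SAW.YangBaxter
open Real Complex

section Reference

/-- The block of the hole-column witness: the `18` faces it visits — root row `(4,2), (5,2)`, the hook `(5,3), (4,3)`, the cell `(3,3)`, the western column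
`(2,3), (2,2), (2,1)`, the bottom row `(3,1) … (6,1)`, the eastern column `(6,2), (6,3), (6,4)`, the top row `(5,4), (4,4), (3,4)`; never the hole `(3,2)`.
[cite: GlazmanManolescu2019, §2.1 (finite domains of faces)] -/
def holeColBlock42 : List Face :=
  [(4,2), (5,2), (5,3), (4,3), (3,3), (2,3), (2,2), (2,1), (3,1), (4,1), (5,1), (6,1), (6,2), (6,3), (6,4), (5,4), (4,4), (3,4)]

/-- The mid-edges of the hole-column witness: east to `p₁ = (5,2)`, north, the hook `(5,3)` west, straight through `(3,3)`, down column `2`, east along row `1`,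
north up column `6`, west along row `4`, down into `(3,3)` through `N`. [cite: GlazmanManolescu2019, §1 (definition of the model), Fig. 1] -/
def holeColMids42 : List MidEdge :=
  [.vert 4 2, .vert 5 2, .slant 5 3, .vert 5 3, .vert 4 3, .vert 3 3, .slant 2 3, .slant 2 2, .vert 3 1, .vert 4 1, .vert 5 1, .vert 6 1, .slant 6 2,
    .slant 6 3, .slant 6 4, .vert 6 4, .vert 5 4, .vert 4 4, .slant 3 4]

/-- The hole-column witness as a walk of its block, from the root `(4,2).side W` to the `N` side of `(3,3)`. [cite: GlazmanManolescu2019, §1 (definition of the model), Fig. 1] -/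
def holeColWalk : YBWalk (dom holeColBlock42) (w42.side .W) (Face.side ((3 : ℤ), (3 : ℤ)) .N) where
  mids := holeColMids42
  head_eq := by decide
  getLast_eq := by decide
  nodup := by decide
  arc_mem := arc_mem_of_check (by decide)
  isChain := by decide
  noncross := noncross_of_check (by decide)

/-- The hole-column witness with its end side `N`. [cite: GlazmanManolescu2019, Lemma 2.1 (walks entering the rhombus through a given side)] -/
def ωHC : ΩG (dom holeColBlock42) (w42.side .W) ((3 : ℤ), (3 : ℤ)) := ⟨.N, holeColWalk⟩

/-- Certificates of the hole-column witness: first hit `4`, `18` arcs, no later arc in the rhombus `(3,3)`, ONE eastern-ray crossing (odd), STRAIGHT first arc, limit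
cost `7`. [cite: Glazman2015WeightedSAW, Lemma 3.1 (proof, pp. 6–7)] [cite: CourantRobbins1958, Ch. V Appendix §2 (the even–odd rule)] [cite: GlazmanManolescu2019, §1, eq. (1); Remark 2.2] -/
theorem ωHC_cert : ωHC.2.firstHitG = 4 ∧ ωHC.2.arcs.length = 18 ∧ (∀ j < 18, 4 < j → ωHC.2.fc j ≠ ((3 : ℤ), (3 : ℤ))) ∧
    Odd ((Finset.range 14).filter fun j => eastRayB w42 (ωHC.2.nth (4 + j + 1)) = true).card ∧
    arcKind (ωHC.2.sIn 4) (ωHC.2.sOut 4) = .straight ∧ cost (slotOfSide ωHC.1) ωHC.2.mids = 7 := by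
  refine ⟨by decide, by decide, by decide, by decide, by decide, by decide⟩

end Reference

/-! ## §3 Translation to an arbitrary root: the witness at `(w.1 − 1, w.2 + 1)` and `VF ≢ 0` modulo the extensions -/

section Translate

variable {Dl : List Face} {w : Face}

/-- The hole-column witness block at the root plaquette `w`: the translate of `holeColBlock42`. [cite: GlazmanManolescu2019, §2.1, §4.2 (translation invariance)] -/
def holeColBlock (w : Face) : List Face := holeColBlock42.map (Face.shiftBy (refShift w))

/-- The reference hole-column witness in the back-translated list containing its block: class `B2a`, odd eastern-ray count, straight first arc, cost `7`, end `N`.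
[cite: Glazman2015WeightedSAW, Lemma 3.1 (proof, pp. 6–7)] [cite: CourantRobbins1958, Ch. V Appendix §2 (the even–odd rule)] -/
private theorem refWitnessHC (hB₀ : ∀ c ∈ holeColBlock42, c ∈ Dl.map (Face.shiftBy (-refShift w))) :
    ∃ (ω₀ : ΩG (dom (Dl.map (Face.shiftBy (-refShift w)))) (w42.side .W) ((3 : ℤ), (3 : ℤ))) (_ : ω₀.IsB2a),
      Odd ((Finset.range ω₀.Mv).filter fun j => eastRayB w42 (ω₀.2.nth (ω₀.2.firstHitG + j + 1)) = true).card ∧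
      arcKind (ω₀.2.sIn ω₀.2.firstHitG) (ω₀.2.sOut ω₀.2.firstHitG) = .straight ∧ cost (slotOfSide ω₀.1) ω₀.2.mids = 7 ∧ (ω₀.1 = .N ∨ ω₀.1 = .S) := by
  obtain ⟨hF, hn, hfc, hodd, hstr, hc⟩ := ωHC_cert
  let ω₀ : ΩG (dom (Dl.map (Face.shiftBy (-refShift w)))) (w42.side .W) ((3 : ℤ), (3 : ℤ)) := ⟨.N, holeColWalk.mapDomain fun c hc => hB₀ c hc⟩
  have hF' : ω₀.2.firstHitG = 4 := hF
  have hn' : ω₀.2.arcs.length = 18 := hn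
  have h₀ : ω₀.IsB2a := by
    refine ΩG.isB2a_of_forall_fc_ne (by rw [hF', hn']; omega) fun j hj1 hj2 => ?_
    rw [hF'] at hj1; rw [hn'] at hj2
    exact hfc j hj2 hj1
  have hM : ω₀.Mv = 14 := by unfold ΩG.Mv; rw [hF', hn']
  exact ⟨ω₀, h₀, by rw [hM, hF']; exact hodd, by rw [hF']; exact hstr, hc, Or.inl rfl⟩

/-- ★★★★ **A WOUND LEVEL-`7` MEMBER AT THE CELL JUST ABOVE THE HOLE, EVERY POSITION.** Every face list containing the block `holeColBlock w` carries, at the hole-column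
rhombus `(w.1 − 1, w.2 + 1)`, a class-`B2a` walk from the root `w.side W` that is WOUND (`A_J ≠ 0`), crosses the rhombus straight at its first arc, has limit cost `7`
and a slanted end. [cite: GlazmanManolescu2019, §4.2 (translation invariance), Lemma 2.1; §1 eq. (1)] [cite: Glazman2015WeightedSAW, Lemma 3.1 (proof, pp. 6–7)]
[cite: CourantRobbins1958, Ch. V Appendix §2 (the even–odd rule)] -/
theorem exists_wound_cost_seven_holeColumn_adjacent_above (hB : ∀ c ∈ holeColBlock w, c ∈ Dl)
    (hr : RootedFace (dom Dl) (w.side .W) (w.1 - 1, w.2 + 1)) :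
    ∃ (ω : ΩG (dom Dl) (w.side .W) (w.1 - 1, w.2 + 1)) (h : ω.IsB2a), ω.AJ hr h (toC (midPt (w.side .W))) ≠ 0 ∧
      arcKind (ω.2.sIn ω.2.firstHitG) (ω.2.sOut ω.2.firstHitG) = .straight ∧ cost (slotOfSide ω.1) ω.2.mids = 7 ∧ (ω.1 = .N ∨ ω.1 = .S) := by
  have hB₀ := block42_mem_of_block_mem (B := holeColBlock42) hB
  have hrr : Face.shiftBy (refShift w) (((3 : ℤ), (3 : ℤ)) : Face) = (w.1 - 1, w.2 + 1) := by
    have := shiftBy_refShift_col w (-1) 1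
    rw [show ((4 : ℤ) + -1, (2 : ℤ) + 1) = (((3 : ℤ), (3 : ℤ)) : Face) by norm_num] at this
    rw [this]; exact Prod.ext (by simp only; omega) rfl
  obtain ⟨ω₀, h₀, hodd, hstr, hc, hz⟩ := refWitnessHC hB₀
  exact ΩG.exists_wound_cost_seven_straight_shift (shiftBy_refShift_root w) hrr hr
    (rootedFace_refShift_back' (shiftBy_refShift_root w) hrr hr) ω₀ h₀ hodd hstr hc hz

open Classical in
/-- ★★★★★ **`VF ≢ 0` JUST ABOVE THE HOLE, MODULO THE EXTENSIONS' PHASES — EXISTENCE DISCHARGED.** For every finite face list `Dl` missing the hole `(w.1 − 1, w.2)` and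
containing the block `holeColBlock w`: IF every cost-`7` extension `ext₃ ω` of a wound `NS` member at `r = (w.1 − 1, w.2 + 1)` has
`limitWeight ∈ {(√2)⁷ζ⁴, (√2)⁷ζ⁸, (√2)⁷ζ¹⁶, (√2)⁷ζ²⁸}`, THEN the printed Yang–Baxter vertex functional `θ ↦ VF_{Dl}(w.side W, r; θ)` has finitely many zeros in
`(0, π)` (at most `4·maxExp − 6`). [cite: GlazmanManolescu2019, Lemma 2.1 (proof: the groups) and eq. (1); Remark 2.2; §4.2] [cite: Glazman2015WeightedSAW, Lemma 3.1 (proof, pp. 6–7)] -/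
theorem vertexFunctional_printed_zero_set_finite_holeColumn_adjacent_above_of_block (hh : holeFaceW w ∉ dom Dl)
    (hB : ∀ c ∈ holeColBlock w, c ∈ Dl) (hr : RootedFace (dom Dl) (w.side .W) (w.1 - 1, w.2 + 1))
    (hB2b : ∀ ω ∈ (ΩG.setB2a (dom Dl) (w.side .W) (w.1 - 1, w.2 + 1)).filter (fun ω => ¬ω.Unwound hr),
      IsNS ω hr → cost (slotOfSide (ω.ext₃ hr).1) (ω.ext₃ hr).2.mids = 7 →
        (limitWeight (slotOfSide (ω.ext₃ hr).1) (ω.ext₃ hr).2.mids = ((Real.sqrt 2 : ℝ) : ℂ) ^ 7 * zeta32 ^ 4 ∨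
          limitWeight (slotOfSide (ω.ext₃ hr).1) (ω.ext₃ hr).2.mids = ((Real.sqrt 2 : ℝ) : ℂ) ^ 7 * zeta32 ^ 8 ∨
          limitWeight (slotOfSide (ω.ext₃ hr).1) (ω.ext₃ hr).2.mids = ((Real.sqrt 2 : ℝ) : ℂ) ^ 7 * zeta32 ^ 16 ∨
          limitWeight (slotOfSide (ω.ext₃ hr).1) (ω.ext₃ hr).2.mids = ((Real.sqrt 2 : ℝ) : ℂ) ^ 7 * zeta32 ^ 28)) :
    {θ ∈ Set.Ioo 0 π | vertexFunctional (printedWeights θ) tFiveEighths (ybCoeff θ) Dl (w.side .W) (w.1 - 1, w.2 + 1) = 0}.Finite ∧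
      {θ ∈ Set.Ioo 0 π | vertexFunctional (printedWeights θ) tFiveEighths (ybCoeff θ) Dl (w.side .W) (w.1 - 1, w.2 + 1) = 0}.ncard ≤
        4 * maxExp Dl (w.side .W) (w.1 - 1, w.2 + 1) + 1 - 7 := by
  refine vertexFunctional_printed_zero_set_finite_holeColumn_adjacent_above Dl hh hr rfl rfl hB2b ?_
  obtain ⟨ω, h, hA, -, hc, -⟩ := exists_wound_cost_seven_holeColumn_adjacent_above hB hr
  refine ⟨ω, ?_, Or.inl hc⟩
  rw [Finset.mem_filter, ΩG.unwound_iff_AJ_root_eq_zero]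
  refine ⟨?_, fun hall => hA (hall h)⟩
  unfold ΩG.setB2a
  rw [Finset.mem_filter]
  exact ⟨Finset.mem_univ _, h⟩

end Translate

end Literature.Barriers.CriticalPhenomena.PlaquetteWalk
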